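import Mathlib
import HarnessLib
import Summits.HubbardSuperconductivity.HubbardSuperconductivity.Theorems.KLProgrammeC4aTadpoleJetAssembly
import Summits.HubbardSuperconductivity.HubbardSuperconductivity.Theorems.KLProgrammeH10TwoPointLimitFrameFermiPoint

/-!
# Route `KLProgramme` — crux C4a, (L3) BRIDGE: `CoMovingJetsL1` for a PAIR-SUM vertex `V(k, q) = B(k + q)` (the particle–particle class) from Fréchet-jet
# majorants of `B` along the co-moving pair sum and the angular jets of the pair-sum path — Bell's formula, complex-valued

Cell `gate-hubbard-kl`, lane hubbard-kl-c4a-1 (g5); helper for stub (C) `stub_twoLeg_curvature` of the engine-flow child `KLRegimeEngineV17F2`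
(stmt-HubbardSuperconductivity-20437); memo HOME/hubbard-kl-c4a-1/C4A-PLAN.md §10 (co-move every loop momentum), §12.4 ((L3) at second order), §22.3 (i).
The (L3) input of the (A) capstone is `CoMovingJetsL1 4 (aV p₀) r μ K (tadpoleVertex β 𝒱_n p₀ − V★)`.  At second order the subtracted vertex is a sum of
BUBBLES read at `k + q` (pp), `k − q` (ph exchange) and `0` (ph direct, θ-blind); for the pp class the co-moving reading is `t ↦ B(S_{ρ,ϑ,θ}(t))` with the
PAIR-SUM PATH `S(t) = Φ(0, θ+t) + Φ(ρ, ϑ+θ+t)`, which is RIGID at the Cooper configuration (`levelPoint_add_levelPoint_add_pi`).  This file separates the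
bookkeeping from the analysis: given (i) θ-uniform majorants `Mb k (ρ,ϑ)` of `‖Dᵏ B‖` at the pair sum, (ii) θ-uniform majorants `Ds i (ρ,ϑ)` of the path's
angular jets, Bell's formula produces the dominators.

* §1 `iteratedDeriv_im`, **`norm_iteratedDeriv_comp_le_bell4_complex`** — `‖∂ʲ(F∘γ)‖ ≤ 2·bell4 M D j` for `F : Momentum → ℂ`, `γ : ℝ → Momentum` (`j ≤ 4`; real and
  imaginary parts through `abs_iteratedDeriv_comp_le_bell`);
* §2 `pairSumPath μ K ρ ϑ θ` / `pairDiffPath` (defs; pp sum `Φ(0,θ+t) + Φ(ρ,ϑ+θ+t)`, ph-exchange difference), `coMoving_pairSum/_pairDiff`, `pairSumPath_cooper`,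
  `pairDiffPath_forward` (the rigid configurations), `contDiff_pairSumPath/_pairDiffPath` (band hypotheses);
* §3 **`coMovingJetsL1_pairSum`** / **`coMovingJetsL1_pairDiff`** — `CoMovingJetsL1 4 (fun i p => 2·bell4 (Mb · p) (Ds · p) i) r μ K (fun k q => B (k ± q))` from (i), (ii) and the integrability
  of these dominators on the chart box (the (L3) analysis proper: `∫dϑ` of the Bell dominators is `n`-free for the scale-resolved bubbles).

Composition only; nothing is asserted about the Hubbard model's sizes; nothing asserts superconductivity.
References: FST II CPAM 51 (1998) §3 Thm 3.5; BGM 2006 §2.4 (2.36)–(2.40) [cite: BenfattoGiulianiMastropietro2006].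
-/

noncomputable section

namespace Summit.HubbardSuperconductivity.HubbardSuperconductivity.Theorems.C4a

set_option linter.dupNamespace false -- summit = problem name (single-conjunct summit), D-0017

open Real Set MeasureTheory Finset
open scoped ContDiff
open Literature.MathematicalPhysics.QuantumLattice Literature.MathematicalPhysics.QuantumLattice.BandSectorCounting Literature.Probability.LatticeModels
open Summit.HubbardSuperconductivity.HubbardSuperconductivity.Theorems.KLRegimeSplit
open Summit.HubbardSuperconductivity.HubbardSuperconductivity.Theorems.DispersionFlow
open Summit.HubbardSuperconductivity.HubbardSuperconductivity.Theorems.PerturbedFermiCurve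

/-! ## §1 Bell's bound for complex-valued compositions -/

/-- `∂ʲ(Im g) = Im(∂ʲ g)` for a `Cʲ` complex-valued function of one real variable. -/
theorem iteratedDeriv_im {g : ℝ → ℂ} {n : ℕ} (hg : ContDiff ℝ n g) (x : ℝ) :
    iteratedDeriv n (fun x : ℝ => (g x).im) x = (iteratedDeriv n g x).im := by
  have hcomp : (fun x : ℝ => (g x).im) = ⇑Complex.imCLM ∘ g := rfl
  rw [iteratedDeriv_eq_iteratedFDeriv, hcomp, Complex.imCLM.iteratedFDeriv_comp_left hg.contDiffAt le_rfl,
    ContinuousLinearMap.compContinuousMultilinearMap_coe, Function.comp_apply, Complex.imCLM_apply, ← iteratedDeriv_eq_iteratedFDeriv]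

/-- **Bell's bound for a complex-valued composition** (`j ≤ 4`): for `F : V → ℂ` of class `C⁴` with `‖DᵏF(γ θ)‖ ≤ M k` (`1 ≤ k ≤ 4`), `‖F(γ θ)‖ ≤ M 0`, and a
`C⁴` curve with `‖γ⁽ⁱ⁾(θ)‖ ≤ D i`: `‖∂ʲ(F ∘ γ)(θ)‖ ≤ 2·bell4 M D j` (real and imaginary parts separately). [cite: BenfattoGiulianiMastropietro2006, §2.4 (2.40)] -/
theorem norm_iteratedDeriv_comp_le_bell4_complex {V : Type*} [NormedAddCommGroup V] [NormedSpace ℝ V] {F : V → ℂ} {γ : ℝ → V}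
    (hF : ContDiff ℝ 4 F) (hγ : ContDiff ℝ 4 γ) {θ : ℝ} {M D : ℕ → ℝ}
    (hM : ∀ k, 1 ≤ k → k ≤ 4 → ‖iteratedFDeriv ℝ k F (γ θ)‖ ≤ M k) (hM0 : ‖F (γ θ)‖ ≤ M 0)
    (hD : ∀ i, 1 ≤ i → i ≤ 4 → ‖iteratedDeriv i γ θ‖ ≤ D i) {j : ℕ} (hj : j ≤ 4) :
    ‖iteratedDeriv j (F ∘ γ) θ‖ ≤ 2 * bell4 M D j := by
  -- real and imaginary parts are real compositions with the same majorants
  have hre : ContDiff ℝ 4 (fun v => (F v).re) := Complex.reCLM.contDiff.comp hF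
  have him : ContDiff ℝ 4 (fun v => (F v).im) := Complex.imCLM.contDiff.comp hF
  have hMre : ∀ k, 1 ≤ k → k ≤ 4 → ‖iteratedFDeriv ℝ k (fun v => (F v).re) (γ θ)‖ ≤ M k := fun k hk1 hk4 => by
    have hcomp : (fun v => (F v).re) = ⇑Complex.reCLM ∘ F := rfl
    rw [hcomp]
    refine (Complex.reCLM.norm_iteratedFDeriv_comp_left hF.contDiffAt (by exact_mod_cast hk4)).trans ?_
    rw [Complex.reCLM_norm, one_mul]
    exact hM k hk1 hk4
  have hMim : ∀ k, 1 ≤ k → k ≤ 4 → ‖iteratedFDeriv ℝ k (fun v => (F v).im) (γ θ)‖ ≤ M k := fun k hk1 hk4 => by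
    have hcomp : (fun v => (F v).im) = ⇑Complex.imCLM ∘ F := rfl
    rw [hcomp]
    refine (Complex.imCLM.norm_iteratedFDeriv_comp_left hF.contDiffAt (by exact_mod_cast hk4)).trans ?_
    rw [Complex.imCLM_norm, one_mul]
    exact hM k hk1 hk4
  obtain ⟨r1, r2, r3, r4⟩ := abs_iteratedDeriv_comp_le_bell hre hγ hMre hD
  obtain ⟨i1, i2, i3, i4⟩ := abs_iteratedDeriv_comp_le_bell him hγ hMim hD
  -- the composition is C⁴, so its real/imaginary parts' jets are the jets of the parts
  have hcomp4 : ContDiff ℝ 4 (F ∘ γ) := hF.comp hγ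
  have hj' : (j : WithTop ℕ∞) ≤ 4 := by exact_mod_cast hj
  have hreF : (fun θ => ((F ∘ γ) θ).re) = (fun v => (F v).re) ∘ γ := rfl
  have himF : (fun θ => ((F ∘ γ) θ).im) = (fun v => (F v).im) ∘ γ := rfl
  have hsplit : ‖iteratedDeriv j (F ∘ γ) θ‖ ≤ |iteratedDeriv j ((fun v => (F v).re) ∘ γ) θ| + |iteratedDeriv j ((fun v => (F v).im) ∘ γ) θ| := by
    rw [← hreF, ← himF, iteratedDeriv_re (hcomp4.of_le hj'), iteratedDeriv_im (hcomp4.of_le hj')]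
    exact Complex.norm_le_abs_re_add_abs_im _
  refine hsplit.trans ?_
  rw [two_mul]
  interval_cases j
  · simp only [iteratedDeriv_zero, Function.comp_apply, bell4]
    exact add_le_add ((Complex.abs_re_le_norm _).trans hM0) ((Complex.abs_im_le_norm _).trans hM0)
  · exact add_le_add r1 i1
  · exact add_le_add r2 i2
  · exact add_le_add r3 i3
  · exact add_le_add r4 i4

/-! ## §2 The pair-sum path -/

/-- **The pair-sum path** of the particle–particle class: `S_{ρ,ϑ,θ}(t) = Φ(0, θ + t) + Φ(ρ, ϑ + θ + t)` — external point and loop point advanced by the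
same angle; RIGID at the Cooper configuration `ϑ = π, ρ = 0` (`S ≡ 0`, `levelPoint_add_levelPoint_add_pi`). -/
def pairSumPath (μ : ℝ) (K : TrigPolyC4v) (ρ ϑ θ : ℝ) (t : ℝ) : Momentum := levelPoint μ K 0 (θ + t) + levelPoint μ K ρ (ϑ + θ + t)

/-- The co-moving reading of `(k, q) ↦ B(k + q)` at base angles `(θ, ϑ + θ)` is `B` along the pair-sum path. -/
theorem coMoving_pairSum (μ : ℝ) (K : TrigPolyC4v) (B : Momentum → ℂ) (θ ρ ϑ : ℝ) :
    coMoving μ K (fun k q => B (k + q)) θ ρ (ϑ + θ) = B ∘ pairSumPath μ K ρ ϑ θ := by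
  funext t
  simp only [coMoving, pairSumPath, Function.comp_apply]

/-- At the Cooper configuration the pair-sum path is identically zero. -/
theorem pairSumPath_cooper (μ : ℝ) (K : TrigPolyC4v) (θ t : ℝ) : pairSumPath μ K 0 π θ t = 0 := by
  unfold pairSumPath
  rw [show π + θ + t = (θ + t) + π by ring, levelPoint_add_pi, add_neg_cancel]

/-- **The pair-difference path** of the particle–hole EXCHANGE class: `D_{ρ,ϑ,θ}(t) = Φ(0, θ + t) − Φ(ρ, ϑ + θ + t)` — RIGID at the forward configuration
`ϑ = 0, ρ = 0` (`D ≡ 0`). -/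
def pairDiffPath (μ : ℝ) (K : TrigPolyC4v) (ρ ϑ θ : ℝ) (t : ℝ) : Momentum := levelPoint μ K 0 (θ + t) - levelPoint μ K ρ (ϑ + θ + t)

/-- The co-moving reading of `(k, q) ↦ B(k − q)` at base angles `(θ, ϑ + θ)` is `B` along the pair-difference path. -/
theorem coMoving_pairDiff (μ : ℝ) (K : TrigPolyC4v) (B : Momentum → ℂ) (θ ρ ϑ : ℝ) :
    coMoving μ K (fun k q => B (k - q)) θ ρ (ϑ + θ) = B ∘ pairDiffPath μ K ρ ϑ θ := by
  funext t
  simp only [coMoving, pairDiffPath, Function.comp_apply]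

/-- At the forward configuration the pair-difference path is identically zero. -/
theorem pairDiffPath_forward (μ : ℝ) (K : TrigPolyC4v) (θ t : ℝ) : pairDiffPath μ K 0 0 θ t = 0 := by
  unfold pairDiffPath
  rw [zero_add, sub_self]

section Band

variable {a b : ℝ} (B : BandBounds a b) {K : TrigPolyC4v} {A : ℝ}
  (hA : ∀ p : Momentum, ∀ j ≤ 2, ‖iteratedFDeriv ℝ j (frameShift K) p‖ ≤ A) (hADt : 2 * A < B.Dtmin)
  {μ r : ℝ} (hr : 0 < r) (hlo : a < μ - r - A) (hhi : μ + r + A < b)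
include B hA hADt hr hlo hhi

omit hr in
/-- The level point at a level inside the tube is `C^∞` in the angle. -/
theorem contDiff_levelPoint_angle {ρ : ℝ} (hρ : |ρ| < r) {m : ℕ∞} : ContDiff ℝ m fun ϑ : ℝ => levelPoint μ K ρ ϑ := by
  have h1 : a ≤ μ + ρ - A := by have := (abs_lt.1 hρ).1; linarith
  have h2 : μ + ρ + A ≤ b := by have := (abs_lt.1 hρ).2; linarith
  have h := contDiff_klFermiPoint B hA hADt (μ := μ + ρ) h1 h2 (m := m)
  unfold levelPoint
  exact ((EuclideanSpace.equiv (Fin 2) ℝ).symm : (Fin 2 → ℝ) →L[ℝ] Momentum).contDiff.comp h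

/-- **The pair-sum path is `C^∞` in `t`** (band hypotheses with tube radius `r`, `|ρ| < r`). -/
theorem contDiff_pairSumPath {ρ : ℝ} (hρ : |ρ| < r) (ϑ θ : ℝ) {m : ℕ∞} : ContDiff ℝ m (pairSumPath μ K ρ ϑ θ) := by
  have h0 : |(0 : ℝ)| < r := by simpa using hr
  exact ((contDiff_levelPoint_angle B hA hADt hlo hhi h0).comp (contDiff_const.add contDiff_id)).add
    ((contDiff_levelPoint_angle B hA hADt hlo hhi hρ).comp (contDiff_const.add contDiff_id))

/-- **The pair-difference path is `C^∞` in `t`** (band hypotheses with tube radius `r`, `|ρ| < r`). -/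
theorem contDiff_pairDiffPath {ρ : ℝ} (hρ : |ρ| < r) (ϑ θ : ℝ) {m : ℕ∞} : ContDiff ℝ m (pairDiffPath μ K ρ ϑ θ) := by
  have h0 : |(0 : ℝ)| < r := by simpa using hr
  exact ((contDiff_levelPoint_angle B hA hADt hlo hhi h0).comp (contDiff_const.add contDiff_id)).sub
    ((contDiff_levelPoint_angle B hA hADt hlo hhi hρ).comp (contDiff_const.add contDiff_id))

/-! ## §3 `CoMovingJetsL1` for a pair-sum / pair-difference vertex from majorants along the path -/

/-- **(L3) BRIDGE, particle–particle class.**  `B : Momentum → ℂ` of class `C⁴`; θ-UNIFORM majorants on the tube: for all `θ` and `|ρ| < r`,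
`‖Dᵏ B(S_{ρ,ϑ,θ}(0))‖ ≤ Mb k (ρ,ϑ)` (`1 ≤ k ≤ 4`), `‖B(S(0))‖ ≤ Mb 0 (ρ,ϑ)`, `‖S⁽ⁱ⁾(0)‖ ≤ Ds i (ρ,ϑ)` (`1 ≤ i ≤ 4`); and the Bell dominators
`2·bell4 (Mb · p) (Ds · p) i` are integrable on the chart box.  Then `CoMovingJetsL1 4 (fun i p => 2·bell4 (fun k => Mb k p) (fun i => Ds i p) i) r μ K (fun k q => B (k+q))`.
[cite: BenfattoGiulianiMastropietro2006, §2.4 (2.36)] -/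
theorem coMovingJetsL1_pairSum {Bf : Momentum → ℂ} (hB : ContDiff ℝ 4 Bf) {Mb Ds : ℕ → ℝ × ℝ → ℝ}
    (hMb : ∀ θ ρ ϑ : ℝ, |ρ| < r → ∀ k, 1 ≤ k → k ≤ 4 → ‖iteratedFDeriv ℝ k Bf (pairSumPath μ K ρ ϑ θ 0)‖ ≤ Mb k (ρ, ϑ))
    (hMb0 : ∀ θ ρ ϑ : ℝ, |ρ| < r → ‖Bf (pairSumPath μ K ρ ϑ θ 0)‖ ≤ Mb 0 (ρ, ϑ))
    (hDs : ∀ θ ρ ϑ : ℝ, |ρ| < r → ∀ i, 1 ≤ i → i ≤ 4 → ‖iteratedDeriv i (pairSumPath μ K ρ ϑ θ) 0‖ ≤ Ds i (ρ, ϑ))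
    (hint : ∀ i ≤ 4, IntegrableOn (fun p : ℝ × ℝ => 2 * bell4 (fun k => Mb k p) (fun i => Ds i p) i) (Ioo (-r) r ×ˢ Ioc 0 (2 * π))) :
    CoMovingJetsL1 4 (fun i p => 2 * bell4 (fun k => Mb k p) (fun i => Ds i p) i) r μ K (fun k q => Bf (k + q)) := by
  refine ⟨hint, fun θ ρ ϑ hρ => ?_⟩
  rw [coMoving_pairSum]
  have hS : ContDiff ℝ 4 (pairSumPath μ K ρ ϑ θ) := contDiff_infty.1 (contDiff_pairSumPath B hA hADt hr hlo hhi hρ ϑ θ (m := ⊤)) 4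
  refine ⟨hB.comp hS, fun i hi => ?_⟩
  exact norm_iteratedDeriv_comp_le_bell4_complex hB hS (hMb θ ρ ϑ hρ) (hMb0 θ ρ ϑ hρ) (hDs θ ρ ϑ hρ) hi

/-- **(L3) BRIDGE, particle–hole exchange class** (`V(k,q) = B(k − q)`, path `pairDiffPath`): as `coMovingJetsL1_pairSum`. [cite: BenfattoGiulianiMastropietro2006, §2.4 (2.36)] -/
theorem coMovingJetsL1_pairDiff {Bf : Momentum → ℂ} (hB : ContDiff ℝ 4 Bf) {Mb Ds : ℕ → ℝ × ℝ → ℝ}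
    (hMb : ∀ θ ρ ϑ : ℝ, |ρ| < r → ∀ k, 1 ≤ k → k ≤ 4 → ‖iteratedFDeriv ℝ k Bf (pairDiffPath μ K ρ ϑ θ 0)‖ ≤ Mb k (ρ, ϑ))
    (hMb0 : ∀ θ ρ ϑ : ℝ, |ρ| < r → ‖Bf (pairDiffPath μ K ρ ϑ θ 0)‖ ≤ Mb 0 (ρ, ϑ))
    (hDs : ∀ θ ρ ϑ : ℝ, |ρ| < r → ∀ i, 1 ≤ i → i ≤ 4 → ‖iteratedDeriv i (pairDiffPath μ K ρ ϑ θ) 0‖ ≤ Ds i (ρ, ϑ))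
    (hint : ∀ i ≤ 4, IntegrableOn (fun p : ℝ × ℝ => 2 * bell4 (fun k => Mb k p) (fun i => Ds i p) i) (Ioo (-r) r ×ˢ Ioc 0 (2 * π))) :
    CoMovingJetsL1 4 (fun i p => 2 * bell4 (fun k => Mb k p) (fun i => Ds i p) i) r μ K (fun k q => Bf (k - q)) := by
  refine ⟨hint, fun θ ρ ϑ hρ => ?_⟩
  rw [coMoving_pairDiff]
  have hS : ContDiff ℝ 4 (pairDiffPath μ K ρ ϑ θ) := contDiff_infty.1 (contDiff_pairDiffPath B hA hADt hr hlo hhi hρ ϑ θ (m := ⊤)) 4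
  refine ⟨hB.comp hS, fun i hi => ?_⟩
  exact norm_iteratedDeriv_comp_le_bell4_complex hB hS (hMb θ ρ ϑ hρ) (hMb0 θ ρ ϑ hρ) (hDs θ ρ ϑ hρ) hi

end Band

end Summit.HubbardSuperconductivity.HubbardSuperconductivity.Theorems.C4a

end
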